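import Literature.NumberTheory.EllipticCurves.BinaryQuarticPadicFibreClassMass
import HarnessLib

/-!
# The orbit sum of Bhargava–Shankar's local density in the `∑'/⨆` form of the function-form change
# of measure: `Σ_{orbits 𝒪 over (I,J)} 1_{soluble}(𝒪)/(m_p(𝒪) · #Aut_{ℤ_p}(𝒪)) = #(E_{I,J}/2E_{I,J}) / #E_{I,J}[2](ℚ_p)`

`Proofs` companion (theorems only: no definitions, no named facts) bridging two renderings of the
fibre sums in the proof of Prop. 5.12 of M. Bhargava, A. Shankar, Ann. of Math. (2) 181 (2015)
191–242 (held arXiv text `arXiv:1006.1002v2`, p. 33; Cor. 3.8 / Prop. 3.9 of the published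
version):

* `BinaryQuarticPadicFibreClassMass.lean` proves **the fibre identity**
  `BinaryQuartic.tsum_solubleFibreOrbits_eq`:
  `∑' q : solubleFibreOrbits (I,J), m_p(q.out)⁻¹ · #Aut_{ℤ_p}(q.out)⁻¹ = localSelmerRatio p (I,J)`,
  summing over the points `q` of the orbit quotient `orbitRel.Quotient GL₂(ℤ_p) V_{ℤ_p}`;
* the function form of the `p`-adic change of measure,
  `BinaryQuartic.lintegral_eq_mul_lintegral_tsum_orbits` (`BinaryQuarticPadicTubeFunctionProofs.lean`),
  produces fibre sums indexed by the orbits as *subsets* of `V_{ℤ_p}`, with the (constant) value of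
  the invariant integrand on an orbit rendered as `⨆` over its points:
  `∑' O : {O // ∃ f, Δ(f) ≠ 0 ∧ (I,J)(f) = (I,J) ∧ GL₂(ℤ_p)·f = O}, ⨆ f ∈ O, Φ f / #Aut_{ℤ_p}(f)`.

This file identifies the two for the weight `Φ = 1_{ℚ_p-soluble}/m_p` of the `2`-Selmer sieve:
§1 the summand is a class function and vanishes on orbits without soluble points; §2 the bijection
`q ↦ orbitRel.Quotient.orbit q` from `solubleFibreOrbits (I,J)` onto the orbit sets with a soluble
point (`tsum_orbits_eq_tsum_solubleFibreOrbits`), whence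
**`tsum_orbits_eq_localSelmerRatio`**, the fibre identity in the `∑'/⨆` form, consumed by the
computation of `∫ φ_p dμ_p` (`BhargavaShankarLocalSievePhiIntegralProofs.lean`).

## References

* M. Bhargava, A. Shankar, Ann. of Math. (2) 181 (2015) 191–242, proof of Prop. 5.12
  (arXiv:1006.1002v2 numbering) = Cor. 3.8, Prop. 3.9 (published numbering).
  [cite: BhargavaShankarAnnals2015, Prop. 5.12 proof (Σ_{f ∈ B_p^{I,J}} 1/#Aut(f); arXiv:1006.1002v2 numbering)]
-/

noncomputable section

open scoped Classical Pointwise ENNReal NNReal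
open Matrix MulAction Set Literature.GroupTheory.Index

namespace Literature.NumberTheory.EllipticCurves

namespace BinaryQuartic

open scoped IntegralAction

variable {p : ℕ} [Fact p.Prime]

/-! ## §1 The summand `1_{soluble}/(m_p · #Aut_{ℤ_p})` on orbits -/

/-- `ℚ_p`-solubility is constant on `GL₂(ℤ_p)`-orbits. [folklore] -/
theorem isSoluble_map_glInt_smul_iff (k : GL (Fin 2) ℤ_[p]) (f : BinaryQuartic ℤ_[p]) :
    ((k • f).map PadicInt.Coe.ringHom).IsSoluble ↔ (f.map PadicInt.Coe.ringHom).IsSoluble := by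
  rw [← mapGL_smul_map]
  exact ((mem_orbit_iff_pgl2Equiv _ _).mp (mem_orbit _ _)).isSoluble_iff

/-- `m_p` is constant on `GL₂(ℤ_p)`-orbits. [cite: BhargavaShankarAnnals2015, §3.2 (published numbering)] -/
theorem localWeight_glInt_smul (k : GL (Fin 2) ℤ_[p]) (f : BinaryQuartic ℤ_[p]) :
    localWeight (k • f) = localWeight f := by
  unfold localWeight
  rw [← mapGL_smul_map, weight_smul]

/-- The value `⨆_{f ∈ G·f₀} Ψ(f)` of a class function on an orbit is its value at `f₀`. [folklore] -/
theorem iSup_orbit_eq_of_invariant {Ψ : BinaryQuartic ℤ_[p] → ℝ≥0∞}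
    (hΨ : ∀ k : GL (Fin 2) ℤ_[p], ∀ f, Ψ (k • f) = Ψ f) (f₀ : BinaryQuartic ℤ_[p]) :
    ⨆ f ∈ orbit (GL (Fin 2) ℤ_[p]) f₀, Ψ f = Ψ f₀ := by
  apply le_antisymm
  · refine iSup₂_le fun f hf ↦ ?_
    obtain ⟨k, rfl⟩ := hf
    rw [hΨ]
  · exact le_iSup₂_of_le f₀ (mem_orbit_self f₀) le_rfl

/-- The summand `1_{soluble}(f)/m_p(f) / #Aut_{ℤ_p}(f)` is a class function. [folklore] -/
theorem solubleWeight_glInt_smul (k : GL (Fin 2) ℤ_[p]) (f : BinaryQuartic ℤ_[p]) :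
    (if ((k • f).map PadicInt.Coe.ringHom).IsSoluble then ((localWeight (k • f) : ℝ≥0∞))⁻¹ else 0) /
        (autCard (k • f) : ℝ≥0∞) =
      (if (f.map PadicInt.Coe.ringHom).IsSoluble then ((localWeight f : ℝ≥0∞))⁻¹ else 0) / (autCard f : ℝ≥0∞) := by
  rw [isSoluble_map_glInt_smul_iff, localWeight_glInt_smul, autCard_smul]

/-- The value of the summand on the orbit of `f₀`. [folklore] -/
theorem iSup_orbit_solubleWeight (f₀ : BinaryQuartic ℤ_[p]) :
    ⨆ f ∈ orbit (GL (Fin 2) ℤ_[p]) f₀, (if (f.map PadicInt.Coe.ringHom).IsSoluble then ((localWeight f : ℝ≥0∞))⁻¹ else 0) /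
        (autCard f : ℝ≥0∞) =
      (if (f₀.map PadicInt.Coe.ringHom).IsSoluble then ((localWeight f₀ : ℝ≥0∞))⁻¹ else 0) / (autCard f₀ : ℝ≥0∞) :=
  iSup_orbit_eq_of_invariant (Ψ := fun f ↦ (if (f.map PadicInt.Coe.ringHom).IsSoluble then
    ((localWeight f : ℝ≥0∞))⁻¹ else 0) / (autCard f : ℝ≥0∞)) solubleWeight_glInt_smul f₀

/-- On a soluble form the summand is `m_p⁻¹ · #Aut_{ℤ_p}⁻¹`. [folklore] -/
theorem solubleWeight_eq_of_isSoluble {f : BinaryQuartic ℤ_[p]} (h : (f.map PadicInt.Coe.ringHom).IsSoluble) :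
    (if (f.map PadicInt.Coe.ringHom).IsSoluble then ((localWeight f : ℝ≥0∞))⁻¹ else 0) / (autCard f : ℝ≥0∞) =
      ((localWeight f : ℝ≥0∞))⁻¹ * ((autCard f : ℝ≥0∞))⁻¹ := by
  rw [if_pos h, div_eq_mul_inv]

/-- Forms with invariants off the discriminant curve have `Δ ≠ 0` (`27Δ = 4I³ − J²`). [folklore] -/
theorem disc_ne_zero_of_invPair_eq {IJ : ℤ_[p] × ℤ_[p]} (hΔ : 4 * IJ.1 ^ 3 - IJ.2 ^ 2 ≠ 0)
    {f : BinaryQuartic ℤ_[p]} (hf : invPair f = IJ) : f.disc ≠ 0 := by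
  intro h0
  have h27 := twentySeven_mul_disc f
  rw [h0, mul_zero] at h27
  simp only [invPair, Prod.ext_iff] at hf
  rw [hf.1, hf.2] at h27
  exact hΔ h27.symm

/-- Reduction of a sum over a subtype to a smaller subtype, when the summand vanishes on the rest.
[folklore] -/
theorem tsum_subtype_eq_tsum_subtype_and {α : Type*} {Q P : α → Prop} {F : α → ℝ≥0∞}
    (hF : ∀ a, Q a → ¬ P a → F a = 0) :
    ∑' a : {a // Q a}, F a = ∑' a : {a // Q a ∧ P a}, F a := by
  have h1 := tsum_subtype {a | Q a} F
  have h2 := tsum_subtype {a | Q a ∧ P a} F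
  have h3 : {a | Q a}.indicator F = {a | Q a ∧ P a}.indicator F := by
    funext a
    by_cases hQ : Q a
    · by_cases hP : P a
      · rw [indicator_of_mem (show a ∈ {a | Q a} from hQ), indicator_of_mem (show a ∈ {a | Q a ∧ P a} from ⟨hQ, hP⟩)]
      · rw [indicator_of_mem (show a ∈ {a | Q a} from hQ),
          indicator_of_notMem (show a ∉ {a | Q a ∧ P a} from fun h ↦ hP h.2), hF a hQ hP]
    · rw [indicator_of_notMem (show a ∉ {a | Q a} from hQ),
        indicator_of_notMem (show a ∉ {a | Q a ∧ P a} from fun h ↦ hQ h.1)]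
  rw [h3, ← h2] at h1
  exact h1

/-! ## §2 From orbit sets to the orbit quotient -/

section Fibre

variable {IJ : ℤ_[p] × ℤ_[p]}

/-- The orbit of a soluble fibre point, as a set, is an orbit set over `(I, J)` with a soluble point
(for `4I³ ≠ J²`). [folklore] -/
theorem orbit_mem_of_mem_solubleFibreOrbits (hΔ : 4 * IJ.1 ^ 3 - IJ.2 ^ 2 ≠ 0)
    {q : orbitRel.Quotient (GL (Fin 2) ℤ_[p]) (BinaryQuartic ℤ_[p])} (hq : q ∈ solubleFibreOrbits IJ) :
    (∃ f : BinaryQuartic ℤ_[p], f.disc ≠ 0 ∧ invPair f = IJ ∧ orbit (GL (Fin 2) ℤ_[p]) f = orbitRel.Quotient.orbit q) ∧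
      ∃ f ∈ orbitRel.Quotient.orbit q, (f.map PadicInt.Coe.ringHom).IsSoluble := by
  obtain ⟨hsol, hI⟩ := out_spec hq
  have hout : Quotient.out q ∈ orbitRel.Quotient.orbit q := by
    rw [orbitRel.Quotient.mem_orbit]; exact Quotient.out_eq' q
  exact ⟨⟨Quotient.out q, disc_ne_zero_of_invPair_eq hΔ hI, hI, (orbit_eq_orbit_out' q).symm⟩,
    Quotient.out q, hout, hsol⟩

/-- Conversely, an orbit set over `(I, J)` with a soluble point is the orbit of a soluble fibre point.
[folklore] -/
theorem mk_mem_solubleFibreOrbits {f : BinaryQuartic ℤ_[p]} (hI : invPair f = IJ)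
    (hsol : ∃ f' ∈ orbit (GL (Fin 2) ℤ_[p]) f, (f'.map PadicInt.Coe.ringHom).IsSoluble) :
    (Quotient.mk'' f : orbitRel.Quotient (GL (Fin 2) ℤ_[p]) (BinaryQuartic ℤ_[p])) ∈ solubleFibreOrbits IJ := by
  obtain ⟨f', ⟨k', rfl⟩, hsol'⟩ := hsol
  have hsolf : (f.map PadicInt.Coe.ringHom).IsSoluble := (isSoluble_map_glInt_smul_iff k' f).mp hsol'
  refine ⟨?_, ?_⟩
  · intro f'' hf''
    rw [orbitRel.Quotient.orbit_mk] at hf''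
    obtain ⟨k, rfl⟩ := hf''
    exact (isSoluble_map_glInt_smul_iff k f).mpr hsolf
  · intro f'' hf''
    rw [orbitRel.Quotient.orbit_mk] at hf''
    obtain ⟨k, rfl⟩ := hf''
    rw [invPair_glInt_smul, hI]

/-- **The two fibre sums agree**: summing `1_{soluble}/(m_p #Aut_{ℤ_p})` over the orbit sets over
`(I, J)` (value on an orbit as `⨆` over its points) equals summing `m_p⁻¹ #Aut_{ℤ_p}⁻¹` over the
soluble fibre points of the orbit quotient (value at `Quotient.out`), for `4I³ ≠ J²`. [folklore] -/
theorem tsum_orbits_eq_tsum_solubleFibreOrbits (hΔ : 4 * IJ.1 ^ 3 - IJ.2 ^ 2 ≠ 0) :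
    (∑' O : {O : Set (BinaryQuartic ℤ_[p]) // ∃ f, f.disc ≠ 0 ∧ invPair f = IJ ∧ orbit (GL (Fin 2) ℤ_[p]) f = O},
        ⨆ f ∈ (O : Set (BinaryQuartic ℤ_[p])),
          (if (f.map PadicInt.Coe.ringHom).IsSoluble then ((localWeight f : ℝ≥0∞))⁻¹ else 0) / (autCard f : ℝ≥0∞)) =
      ∑' q : solubleFibreOrbits IJ,
        ((localWeight (Quotient.out (q : orbitRel.Quotient (GL (Fin 2) ℤ_[p]) (BinaryQuartic ℤ_[p]))) : ℝ≥0∞))⁻¹ *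
          ((autCard (Quotient.out (q : orbitRel.Quotient (GL (Fin 2) ℤ_[p]) (BinaryQuartic ℤ_[p]))) : ℝ≥0∞))⁻¹ := by
  -- Step 1: drop the orbits without soluble points
  rw [tsum_subtype_eq_tsum_subtype_and
    (Q := fun O : Set (BinaryQuartic ℤ_[p]) ↦ ∃ f, f.disc ≠ 0 ∧ invPair f = IJ ∧ orbit (GL (Fin 2) ℤ_[p]) f = O)
    (P := fun O ↦ ∃ f ∈ O, (f.map PadicInt.Coe.ringHom).IsSoluble)
    (F := fun O ↦ ⨆ f ∈ O, (if (f.map PadicInt.Coe.ringHom).IsSoluble then ((localWeight f : ℝ≥0∞))⁻¹ else 0) /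
      (autCard f : ℝ≥0∞)) ?_]
  swap
  · rintro O ⟨f₀, -, -, rfl⟩ hP
    rw [iSup_orbit_solubleWeight, if_neg (fun h ↦ hP ⟨f₀, mem_orbit_self f₀, h⟩), ENNReal.zero_div]
  -- Step 2: the bijection `q ↦ orbit q` from the soluble fibre points
  let ψ : solubleFibreOrbits IJ →
      {O : Set (BinaryQuartic ℤ_[p]) // (∃ f, f.disc ≠ 0 ∧ invPair f = IJ ∧ orbit (GL (Fin 2) ℤ_[p]) f = O) ∧
        ∃ f ∈ O, (f.map PadicInt.Coe.ringHom).IsSoluble} :=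
    fun q ↦ ⟨orbitRel.Quotient.orbit (q : orbitRel.Quotient (GL (Fin 2) ℤ_[p]) (BinaryQuartic ℤ_[p])),
      orbit_mem_of_mem_solubleFibreOrbits hΔ q.2⟩
  have hψ : Function.Bijective ψ := by
    constructor
    · intro q q' h
      have h' := congrArg Subtype.val h
      exact Subtype.ext (orbitRel.Quotient.orbit_injective h')
    · rintro ⟨O, ⟨f, hΔf, hI, rfl⟩, hsol⟩
      refine ⟨⟨Quotient.mk'' f, mk_mem_solubleFibreOrbits hI hsol⟩, Subtype.ext ?_⟩
      exact orbitRel.Quotient.orbit_mk f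
  rw [← (Equiv.ofBijective ψ hψ).tsum_eq]
  refine tsum_congr fun q ↦ ?_
  obtain ⟨hsol, -⟩ := out_spec q.2
  show (⨆ f ∈ orbitRel.Quotient.orbit (q : orbitRel.Quotient (GL (Fin 2) ℤ_[p]) (BinaryQuartic ℤ_[p])), _) = _
  rw [orbit_eq_orbit_out', iSup_orbit_solubleWeight, solubleWeight_eq_of_isSoluble hsol]

/-- **The orbit sum of the local density, `∑'/⨆` form** (Bhargava–Shankar, proof of Prop. 5.12 /
Cor. 3.8 and Lemmas 5.10–5.11, via `BinaryQuartic.tsum_solubleFibreOrbits_eq`). Let `(I, J) ∈ ℤ_p²`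
with `4I³ ≠ J²`, and suppose every `ℚ_p`-soluble binary quartic form over `ℚ_p` with invariants
`(I, J)` is `PGL₂(ℚ_p)`-equivalent to a form in `V_{ℤ_p}`. Then, summing over the `GL₂(ℤ_p)`-orbits
`𝒪` in `V_{ℤ_p}` with invariants `(I, J)`,
`Σ_𝒪 1_{ℚ_p-soluble}(𝒪) / (m_p(𝒪) · #Aut_{ℤ_p}(𝒪)) = #(E_{I,J}(ℚ_p)/2E_{I,J}(ℚ_p)) / #E_{I,J}(ℚ_p)[2]`
(`= localSelmerRatio p (I, J)`), the sum rendered as in the orbit form of the change of measure.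
[cite: BhargavaShankarAnnals2015, Prop. 5.12 proof (arXiv:1006.1002v2 numbering) = Cor. 3.8, Prop. 3.9 (published numbering)] -/
theorem tsum_orbits_eq_localSelmerRatio (hΔ : 4 * IJ.1 ^ 3 - IJ.2 ^ 2 ≠ 0)
    (hint : ∀ F : BinaryQuartic ℚ_[p], F.I = (IJ.1 : ℚ_[p]) → F.J = (IJ.2 : ℚ_[p]) → F.IsSoluble →
      ∃ g : BinaryQuartic ℤ_[p], PGL2Equiv F (g.map PadicInt.Coe.ringHom)) :
    (∑' O : {O : Set (BinaryQuartic ℤ_[p]) // ∃ f, f.disc ≠ 0 ∧ invPair f = IJ ∧ orbit (GL (Fin 2) ℤ_[p]) f = O},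
        ⨆ f ∈ (O : Set (BinaryQuartic ℤ_[p])),
          (if (f.map PadicInt.Coe.ringHom).IsSoluble then ((localWeight f : ℝ≥0∞))⁻¹ else 0) / (autCard f : ℝ≥0∞)) =
      ENNReal.ofReal (localSelmerRatio p IJ) := by
  rw [tsum_orbits_eq_tsum_solubleFibreOrbits hΔ, tsum_solubleFibreOrbits_eq hΔ hint]

end Fibre

end BinaryQuartic

end Literature.NumberTheory.EllipticCurves

end
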